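import Literature.MathematicalPhysics.QuantumLattice.HeatKernelGroup
import HarnessLib

/-!
# The heat-kernel lattice measure is a probability measure

Sibling proof file of `Literature/MathematicalPhysics/QuantumLattice/HeatKernelGroup.lean`
(D-0014: Literature is sorry-free; named facts are discharged as `theorem X_holds : X`), next to
`HeatKernelGroupProofs.lean` (`comp_mul`), `HeatKernelGroupGaugeProofs.lean`
(`groupHeatKernelWeight_gaugeTransform`) and `HeatKernelGroupCircleProofs.lean`
(`circleHeatKernel_eq_jacobiTheta₂`).  It discharges two further named facts of that file,
without introducing or changing any statement (all auxiliary declarations below are proved):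

* `Literature.MathematicalPhysics.QuantumLattice.IsGroupHeatKernel.apply_one_pos_holds :
  IsGroupHeatKernel.apply_one_pos` — a heat kernel is strictly positive at the identity,
  `p_t(1) = ∫ p_{t/2}(h)² dh > 0` (Stein 1970 Ch. II §2);
* `Literature.MathematicalPhysics.QuantumLattice.isProbabilityMeasure_groupHeatKernelMeasure_holds :
  isProbabilityMeasure_groupHeatKernelMeasure` — for a heat kernel `p` and `t > 0` the
  heat-kernel lattice gauge measure `groupHeatKernelMeasure p t = Z⁻¹ ∏_q p_t(U_q) ∏_e dU_e` on the
  torus `(ℤ/L)^d` is a probability measure, i.e. its partition function `Z` is finite and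
  non-zero (Driver, CMP **123** (1989) §7, (7.1)–(7.4), where the normalised lattice measures of an
  action function are introduced; the normalisability itself is the routine estimate below).

## Sources

* B. K. Driver, *YM₂: continuum expectations, lattice convergence, and lassos*, Comm. Math.
  Phys. **123** (1989) 575–616, §7, Def. 7.1 and (7.1)–(7.4), pp. 597–598 (lattice action functions and
  their normalised measures; the heat kernel as the action function: §8, Def. 8.3, p. 601).
  [cite: Driver1989, §7 (7.1)–(7.4) (pp. 597–598)]
* E. M. Stein, *Topics in Harmonic Analysis Related to the Littlewood–Paley Theory* (1970),
  Ch. II §2 (heat semigroup on a compact group: positivity, semigroup law). [cite: Stein1970, Ch. II §2]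

## Proof architecture

* `IsGroupHeatKernel.apply_one_eq_integral_mul_self`: by the semigroup law at `1` and inversion
  symmetry, `p_t(1) = ∫ p_{t/2}(h) p_{t/2}(h⁻¹) dh = ∫ p_{t/2}(h)² dh`.
* `IsGroupHeatKernel.apply_one_pos_holds`: `p_{t/2}` is continuous, `≥ 0`, with Haar integral
  `1`, hence not identically zero; Haar measure charges open sets (`IsOpenPosMeasure`), so
  `∫ p_{t/2}² > 0`.
* `Z < ∞`: `p_t` is continuous on the compact group, hence bounded by some `M`, so the weight
  `∏_q p_t(U_q) ≤ M ^ #plaquettes` and `Z ≤ M ^ #plaquettes` (product Haar is a probability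
  measure).  Only the monotonicity of the lower Lebesgue integral is used, so no measurability of
  the weight (i.e. no second countability of `G`) is needed.
* `Z > 0` (`exists_box_le_groupHeatKernelWeight`): `V = {g | p_t(1)/2 < p_t(g)}` is an open
  neighbourhood of `1`; each plaquette holonomy `U ↦ U_q` is continuous for the product topology
  and trivial at the trivial configuration, so `{U | ∀ q, U_q ∈ V}` is an open neighbourhood of
  `1 : Edge → G` and contains a box `∏_e W_e` of open neighbourhoods `W_e ∋ 1`; on the box the
  weight is `≥ (p_t(1)/2) ^ #plaquettes > 0`, and the box has product-Haar mass `∏_e Haar(W_e) > 0`.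
* `measure_univ`: `Z⁻¹ · Z = 1` in `ℝ≥0∞` for `Z ∉ {0, ∞}`.
-/

open MeasureTheory Filter Topology
open Literature.MathematicalPhysics.QuantumFieldTheory (haarProbability GaugeConfig Plaquette Edge Site
  plaquetteHolonomy)

noncomputable section

namespace Literature.MathematicalPhysics.QuantumLattice

variable {G : Type*} [Group G] [TopologicalSpace G] [IsTopologicalGroup G] [CompactSpace G]
  [MeasurableSpace G] [BorelSpace G]

/-! ### Positivity of the heat kernel at the identity -/

namespace IsGroupHeatKernel

variable {p : ℝ → G → ℝ}

/-- `p_t(1) = ∫ p_{t/2}(h) p_{t/2}(h) dh`: the semigroup law `p_{s+t}(g) = ∫ p_s(h) p_t(h⁻¹g) dh`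
at `g = 1`, `s = t/2`, combined with the inversion symmetry `p_{t/2}(h⁻¹) = p_{t/2}(h)`
(Stein 1970 Ch. II §2). [cite: Stein1970, Ch. II §2] -/
theorem apply_one_eq_integral_mul_self (hp : IsGroupHeatKernel p) {t : ℝ} (ht : 0 < t) :
    p t 1 = ∫ h, p (t / 2) h * p (t / 2) h ∂(haarProbability G) := by
  have h2 : 0 < t / 2 := half_pos ht
  have key := hp.semigroup (t / 2) (t / 2) h2 h2 1
  rw [add_halves] at key
  rw [key]
  refine integral_congr_ae (Eventually.of_forall fun h => ?_)
  simp only [mul_one, hp.symm _ h2]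

/-- **Discharge of `IsGroupHeatKernel.apply_one_pos`**: a heat kernel is strictly positive at the
identity, `p_t(1) = ∫ p_{t/2}² dHaar > 0`, because `p_{t/2}` is a continuous non-negative
function with Haar integral `1` (so not identically zero) and Haar measure charges every
non-empty open set (Stein 1970 Ch. II §2). [cite: Stein1970, Ch. II §2] -/
theorem apply_one_pos_holds : apply_one_pos (G := G) (p := p) := by
  intro hp t ht
  have h2 : 0 < t / 2 := half_pos ht
  rw [hp.apply_one_eq_integral_mul_self ht]
  have hc : Continuous (p (t / 2)) := hp.continuous h2
  haveI : (haarProbability G).IsOpenPosMeasure := by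
    rw [haarProbability]
    infer_instance
  have hne : p (t / 2) ≠ 0 := fun h0 => by
    have h1 := hp.integral_eq_one (t / 2) h2
    simp only [h0, Pi.zero_apply, integral_zero] at h1
    exact zero_ne_one h1
  obtain ⟨g₀, hg₀⟩ := Function.ne_iff.mp hne
  exact (hc.mul hc).integral_pos_of_hasCompactSupport_nonneg_nonzero (x := g₀)
    (HasCompactSupport.of_compactSpace _) (fun g => mul_self_nonneg _) (mul_ne_zero hg₀ hg₀)

end IsGroupHeatKernel

/-! ### Normalisability of the heat-kernel lattice measure -/

section Lattice

variable {d L : ℕ}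

omit [CompactSpace G] [MeasurableSpace G] [BorelSpace G] in
/-- A plaquette holonomy `U ↦ U_q = U(x,i) U(x+eᵢ,j) U(x+eⱼ,i)⁻¹ U(x,j)⁻¹` is a continuous function
of the configuration for the product topology on `Edge → G`. [folklore] -/
theorem continuous_plaquetteHolonomy (x : Site d L) (i j : Fin d) :
    Continuous fun U : GaugeConfig d L G => plaquetteHolonomy U x i j := by
  unfold plaquetteHolonomy
  fun_prop

omit [TopologicalSpace G] [IsTopologicalGroup G] [CompactSpace G] [MeasurableSpace G]
  [BorelSpace G] in
/-- The plaquette holonomies of the trivial configuration are trivial. [folklore] -/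
@[simp] theorem plaquetteHolonomy_one (x : Site d L) (i j : Fin d) :
    plaquetteHolonomy (1 : GaugeConfig d L G) x i j = 1 := by
  simp [plaquetteHolonomy]

/-- The heat-kernel weight is bounded above: `∏_q p_t(U_q) ≤ M ^ #plaquettes` whenever
`p_t ≤ M` (and `p_t ≥ 0`). [folklore] -/
theorem groupHeatKernelWeight_le_pow [NeZero L] {p : ℝ → G → ℝ} (hp : IsGroupHeatKernel p)
    {t : ℝ} (ht : 0 < t) {M : ℝ} (hM : ∀ g, p t g ≤ M) (U : GaugeConfig d L G) :
    groupHeatKernelWeight p t U ≤ M ^ Fintype.card (Plaquette d L) := by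
  unfold groupHeatKernelWeight
  calc ∏ q : Plaquette d L, p t (plaquetteHolonomy U q.1 q.2.1.1 q.2.1.2)
      ≤ ∏ _q : Plaquette d L, M :=
        Finset.prod_le_prod (fun q _ => hp.nonneg t ht _) (fun q _ => hM _)
    _ = M ^ Fintype.card (Plaquette d L) := by rw [Finset.prod_const, Finset.card_univ]

/-- **Lower bound near the trivial configuration.**  For a heat kernel `p` and `t > 0` there are
open neighbourhoods `W_e ∋ 1` of the identity, one per edge, such that on the box
`{U | ∀ e, U_e ∈ W_e}` every plaquette holonomy lies in `{g | p_t(1)/2 < p_t(g)}`, whence the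
heat-kernel weight is at least `(p_t(1)/2) ^ #plaquettes` there (continuity of `p_t` and of the
holonomies; `p_t(1) > 0` by `IsGroupHeatKernel.apply_one_pos_holds`). [folklore] -/
theorem exists_box_le_groupHeatKernelWeight [NeZero L] {p : ℝ → G → ℝ} (hp : IsGroupHeatKernel p)
    {t : ℝ} (ht : 0 < t) :
    ∃ W : Edge d L → Set G, (∀ e, IsOpen (W e) ∧ (1 : G) ∈ W e) ∧
      ∀ U : GaugeConfig d L G, U ∈ Set.univ.pi W →
        (p t 1 / 2) ^ Fintype.card (Plaquette d L) ≤ groupHeatKernelWeight p t U := by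
  have hpos : 0 < p t 1 := IsGroupHeatKernel.apply_one_pos_holds hp ht
  set V : Set G := {g | p t 1 / 2 < p t g} with hV
  have hVo : IsOpen V := isOpen_lt continuous_const (hp.continuous ht)
  set O : Set (GaugeConfig d L G) :=
    {U | ∀ q : Plaquette d L, plaquetteHolonomy U q.1 q.2.1.1 q.2.1.2 ∈ V} with hO_def
  have hO : IsOpen O := by
    have hO' : O = ⋂ q : Plaquette d L,
        (fun U : GaugeConfig d L G => plaquetteHolonomy U q.1 q.2.1.1 q.2.1.2) ⁻¹' V := by
      ext U
      simp [hO_def]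
    rw [hO']
    exact isOpen_iInter_of_finite fun q => hVo.preimage (continuous_plaquetteHolonomy _ _ _)
  have h1O : (1 : GaugeConfig d L G) ∈ O := by
    intro q
    simp only [plaquetteHolonomy_one, hV, Set.mem_setOf_eq]
    exact half_lt_self hpos
  obtain ⟨W, hW, hWO⟩ := isOpen_pi_iff'.mp hO 1 h1O
  refine ⟨W, fun e => ⟨(hW e).1, (hW e).2⟩, fun U hU => ?_⟩
  have hUO : U ∈ O := hWO hU
  unfold groupHeatKernelWeight
  calc (p t 1 / 2) ^ Fintype.card (Plaquette d L) = ∏ _q : Plaquette d L, (p t 1 / 2) := by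
          rw [Finset.prod_const, Finset.card_univ]
    _ ≤ ∏ q : Plaquette d L, p t (plaquetteHolonomy U q.1 q.2.1.1 q.2.1.2) :=
        Finset.prod_le_prod (fun _ _ => (half_pos hpos).le) (fun q _ => (hUO q).le)

/-- The partition function of the heat-kernel lattice action,
`Z = ∫ ∏_q p_t(U_q) ∏_e dU_e` (as a lower Lebesgue integral against product Haar measure), is
finite: the weight is bounded by `M ^ #plaquettes` and product Haar is a probability measure. [folklore] -/
theorem lintegral_groupHeatKernelWeight_ne_top [NeZero L] {p : ℝ → G → ℝ}
    (hp : IsGroupHeatKernel p) {t : ℝ} (ht : 0 < t) :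
    ∫⁻ U, ENNReal.ofReal (groupHeatKernelWeight p t U)
        ∂(Measure.pi fun _ : Edge d L => haarProbability G) ≠ ⊤ := by
  obtain ⟨M, hM⟩ : ∃ M, ∀ g, p t g ≤ M := by
    obtain ⟨M, hM⟩ := (isCompact_range (hp.continuous ht)).bddAbove
    exact ⟨M, fun g => hM ⟨g, rfl⟩⟩
  have hle : ∫⁻ U, ENNReal.ofReal (groupHeatKernelWeight p t U)
        ∂(Measure.pi fun _ : Edge d L => haarProbability G) ≤
      ∫⁻ _U, ENNReal.ofReal (M ^ Fintype.card (Plaquette d L))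
        ∂(Measure.pi fun _ : Edge d L => haarProbability G) :=
    lintegral_mono fun U => ENNReal.ofReal_le_ofReal (groupHeatKernelWeight_le_pow hp ht hM U)
  refine ne_top_of_le_ne_top ?_ hle
  rw [lintegral_const]
  exact ENNReal.mul_ne_top ENNReal.ofReal_ne_top (measure_ne_top _ _)

/-- The partition function of the heat-kernel lattice action is non-zero: on a box of positive
product-Haar mass around the trivial configuration the weight is bounded below by a positive
constant (`exists_box_le_groupHeatKernelWeight`; Haar measure charges open sets). [folklore] -/
theorem lintegral_groupHeatKernelWeight_ne_zero [NeZero L] {p : ℝ → G → ℝ}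
    (hp : IsGroupHeatKernel p) {t : ℝ} (ht : 0 < t) :
    ∫⁻ U, ENNReal.ofReal (groupHeatKernelWeight p t U)
        ∂(Measure.pi fun _ : Edge d L => haarProbability G) ≠ 0 := by
  haveI : (haarProbability G).IsOpenPosMeasure := by
    rw [haarProbability]
    infer_instance
  have hpos : 0 < p t 1 := IsGroupHeatKernel.apply_one_pos_holds hp ht
  obtain ⟨W, hW, hWle⟩ := exists_box_le_groupHeatKernelWeight (d := d) (L := L) hp ht
  have hS : MeasurableSet (Set.univ.pi W) :=
    MeasurableSet.univ_pi fun e => (hW e).1.measurableSet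
  have hc0 : 0 < (p t 1 / 2) ^ Fintype.card (Plaquette d L) := pow_pos (half_pos hpos) _
  have hle : (Set.univ.pi W).indicator
        (fun _ => ENNReal.ofReal ((p t 1 / 2) ^ Fintype.card (Plaquette d L))) ≤
      fun U : GaugeConfig d L G => ENNReal.ofReal (groupHeatKernelWeight p t U) := by
    intro U
    by_cases hU : U ∈ Set.univ.pi W
    · simp only [Set.indicator_of_mem hU]
      exact ENNReal.ofReal_le_ofReal (hWle U hU)
    · simp only [Set.indicator_of_notMem hU]
      exact bot_le
  have hlow := lintegral_mono (μ := Measure.pi fun _ : Edge d L => haarProbability G) hle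
  rw [lintegral_indicator_const hS, Measure.pi_pi] at hlow
  refine ne_of_gt (lt_of_lt_of_le ?_ hlow)
  refine ENNReal.mul_pos (ENNReal.ofReal_pos.2 hc0).ne' ?_
  exact Finset.prod_ne_zero_iff.2 fun e _ => ((hW e).1.measure_pos _ ⟨1, (hW e).2⟩).ne'

/-- Unfolding of `groupHeatKernelMeasure`: `μ_t = Z⁻¹ • w` with
`w = (∏_e dHaar).withDensity (∏_q p_t(U_q))` and `Z = w univ`. [folklore] -/
theorem groupHeatKernelMeasure_eq [NeZero L] (p : ℝ → G → ℝ) (t : ℝ) :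
    groupHeatKernelMeasure (d := d) (L := L) p t =
      (((Measure.pi fun _ : Edge d L => haarProbability G).withDensity
          fun U => ENNReal.ofReal (groupHeatKernelWeight p t U)) Set.univ)⁻¹ •
        (Measure.pi fun _ : Edge d L => haarProbability G).withDensity
          fun U => ENNReal.ofReal (groupHeatKernelWeight p t U) :=
  rfl

/-- **Discharge of `isProbabilityMeasure_groupHeatKernelMeasure`** (Driver, CMP 123 (1989) §7, (7.1)):
for a heat kernel `p` (`IsGroupHeatKernel p`) and `t > 0` the normalised heat-kernel lattice
gauge measure `groupHeatKernelMeasure p t` on configurations of the torus `(ℤ/L)^d`, `L ≠ 0`, is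
a probability measure — its partition function is finite
(`lintegral_groupHeatKernelWeight_ne_top`) and non-zero
(`lintegral_groupHeatKernelWeight_ne_zero`), so `Z⁻¹ · Z = 1`. [cite: Driver1989, §7 (7.1) (p. 597)] -/
theorem isProbabilityMeasure_groupHeatKernelMeasure_holds :
    isProbabilityMeasure_groupHeatKernelMeasure (G := G) (d := d) (L := L) := by
  intro _ p hp t ht
  have h_univ : ((Measure.pi fun _ : Edge d L => haarProbability G).withDensity
        fun U => ENNReal.ofReal (groupHeatKernelWeight p t U)) Set.univ =
      ∫⁻ U, ENNReal.ofReal (groupHeatKernelWeight p t U)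
        ∂(Measure.pi fun _ : Edge d L => haarProbability G) := by
    rw [withDensity_apply _ MeasurableSet.univ, Measure.restrict_univ]
  rw [groupHeatKernelMeasure_eq]
  refine ⟨?_⟩
  rw [Measure.smul_apply, smul_eq_mul, h_univ]
  exact ENNReal.inv_mul_cancel (lintegral_groupHeatKernelWeight_ne_zero hp ht)
    (lintegral_groupHeatKernelWeight_ne_top hp ht)

end Lattice

end Literature.MathematicalPhysics.QuantumLattice
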